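import Mathlib
import HarnessLib
import Literature.Analysis.FluidPDE.Tao2016AveragedNS.BoundedEternalSolutions
import Summits.NavierStokesRegularity.NavierStokesRegularity.Theorems.TaoLadderRungTwoBreakEternalRigidityViscBddOneViscousTypeILawLimit
import Summits.NavierStokesRegularity.NavierStokesRegularity.Theorems.TaoLadderRungTwoBreakEternalRigidityViscBddOneDefs
import Summits.NavierStokesRegularity.NavierStokesRegularity.Theorems.TaoLadderRungTwoBreakEternalRigidityViscBddOneCriticalRate
import Summits.NavierStokesRegularity.NavierStokesRegularity.Theorems.TaoLadderRungTwoBreakEternalRigidityViscBddOneFrontClock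
import Summits.NavierStokesRegularity.NavierStokesRegularity.Theorems.TaoLadderRungTwoBreakEternalRigidityViscBddOneFrontEnvelopeClock
import Summits.NavierStokesRegularity.NavierStokesRegularity.Theorems.WakeRatchetMinimalViscousBlowupThresholdContinuity
import Summits.NavierStokesRegularity.NavierStokesRegularity.Theorems.TaoLadderRungTwoBreakBlowupRigidityOneAdmissibleEternalLimit

/-!
# Crux `TaoLadderRungTwoBreak.EternalRigidityViscBddOne` (stmt-NavierStokesRegularity-20420): the (ω4) stub `stub_eternalLimitViscBdd` CONDITIONALLY —
# TYPE I + FRONT a=1 ENVELOPE + WAKE CALMING + UNIFORM CRITICAL ACTION ⟹ `∃ ν̂ W, IsEternalVisc ε₀ ν̂ α W ∧ UniformBound W ∧ EternalSurvivingFwd 1 ε₀ W`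

MODEL lattice ODEs only (Tao 2016 §4, `m = 4`, registered vocabulary `ViscousUpTo`/`BlowsUpAt`/`TypeOne` of the skeleton `85fbfe8e90eea58b`); nothing here
is a statement about the Navier–Stokes equations; no stub, crux or summit is closed (`--supports stmt-NavierStokesRegularity-20420`).
`eternalLimitViscBdd_of_frontData` — the registered conclusion of (ω4), VERBATIM in shape, from `ViscousUpTo ∧ BlowsUpAt ∧ TypeOne` plus three typed
dynamical statements about the blow-up trajectory: (FE) front a=1 envelope at late critical-front modes; (WC) wake calming
`Λ^{n+F}(t⋆−t_a)‖X_{n+F}(t)‖ ≤ P n` after every late anchor; (UA) uniform critical action `Λ^k∫₀^{t⋆}‖X_k‖ ≤ A` (tree `translate_window_action`).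
Mechanism: the front-anchored extraction of `ViscousTypeISurvival` (two-sided clock ⟹ survival), the `bdd` clause from (WC) pointwise, the `action`
clause from (UA) by dominated convergence on windows (pattern of `ClockedFrontLimitData`).  READING for ⟨20420⟩: (ω4) ⟸ (ω3) ∧ (FE) ∧ (WC) ∧ (UA),
kernel-checked; the three hypotheses are the honest residual (none follows from energy + type I).  HONEST LABEL: conditional; (ω3), (ω4), ⟨20420⟩
and every NS statement remain OPEN; rung 0.
-/

noncomputable section

-- the summit and its single sub-problem share the name (CONVENTIONS §1)
set_option linter.dupNamespace false

open Set Filter Topology MeasureTheory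
open Literature.Analysis.FluidPDE Literature.Analysis.FluidPDE.TaoCascade
open Summit.NavierStokesRegularity.NavierStokesRegularity.Theorems.BlowupRigidityOne
open Summit.NavierStokesRegularity.NavierStokesRegularity.Theorems.MinimalViscousBlowup.ThresholdRay
open Summit.NavierStokesRegularity.NavierStokesRegularity.Theorems.EternalRigidityViscBddOne.Birth
open Summit.NavierStokesRegularity.NavierStokesRegularity.Theorems.EternalRigidityViscBddOne.CriticalRate
open Summit.NavierStokesRegularity.NavierStokesRegularity.Theorems.EternalRigidityViscBddOne.CriticalFront
open Summit.NavierStokesRegularity.NavierStokesRegularity.Theorems.EternalRigidityViscBddOne.FrontClock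

namespace Summit.NavierStokesRegularity.NavierStokesRegularity.Theorems.EternalRigidityViscBddOne.ViscousLawLimit

set_option maxHeartbeats 400000 in
/-- **(ω4) from type I and the three front data (FE), (WC), (UA).**  The registered conclusion shape of `stub_eternalLimitViscBdd`:
`∃ ν̂ W, IsEternalVisc ε₀ ν̂ α W ∧ UniformBound W ∧ EternalSurvivingFwd 1 ε₀ W` (indeed `ν̂ > 0` and `‖W_0(0)‖ ≥ 1/(32(3+Λ))`).  MODEL lattice only.
[cite: Tao2016AveragedNS, §4 Thm. 4.2 (statement shape), the viscous equation before it, §6.4; KochNadirashviliSereginSverak2009, Thm 1.1 ff.; Teschl2012, §2.6; cell vocabulary (stmt-NavierStokesRegularity-20420)] -/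
theorem eternalLimitViscBdd_of_frontData {R ε₀ ν : ℝ} (hε₀ : 0 < ε₀) (hν : 0 < ν)
    {α : Fin 4 → Fin 4 → Fin 4 → ℤ × ℤ × ℤ → ℝ} (hα : InTableClass R α) {X₀ : Fin 4 → ℝ}
    {X : Fin 4 → ℤ → ℝ → ℝ} {tStar : ℝ} (hV : ViscousUpTo ε₀ ν α X₀ X tStar) (hB : BlowsUpAt ε₀ X tStar)
    (hT1 : TypeOne ε₀ X tStar)
    (hEnv : ∃ Q t₂ : ℝ, t₂ < tStar ∧ ∀ t : ℝ, 0 ≤ t → t₂ ≤ t → t < tStar → ∀ (i : Fin 4) (F : ℤ),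
      1 / (32 * (3 + bigLam ε₀)) ≤ bigLam ε₀ ^ F * |X i F t| * (tStar - t) →
        (1 + ε₀) ^ ((F : ℝ) / 2) * |X i F t| ≤ Q)
    {P : ℤ → ℝ} (hWC : ∃ t₃ : ℝ, t₃ < tStar ∧ ∀ ta : ℝ, 0 ≤ ta → t₃ ≤ ta → ta < tStar → ∀ (i : Fin 4) (F : ℤ),
      1 / (32 * (3 + bigLam ε₀)) ≤ bigLam ε₀ ^ F * |X i F ta| * (tStar - ta) →
        ∀ (n : ℤ) (t : ℝ), ta ≤ t → t < tStar → bigLam ε₀ ^ (n + F) * (tStar - ta) * ‖shellVec X (n + F) t‖ ≤ P n)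
    {A : ℝ} (hUA : ∀ k : ℤ, IntegrableOn (fun t => ‖shellVec X k t‖) (Ico 0 tStar) ∧
      bigLam ε₀ ^ k * (∫ t in Ico 0 tStar, ‖shellVec X k t‖) ≤ A) :
    ∃ νh : ℝ, 0 < νh ∧ ∃ W : ℤ → ℝ → Em 4,
      IsEternalVisc ε₀ νh α W ∧ UniformBound W ∧ EternalSurvivingFwd 1 ε₀ W ∧ 1 / (32 * (3 + bigLam ε₀)) ≤ ‖W 0 0‖ := by
  have hl0 : (0 : ℝ) < 1 + ε₀ := by linarith
  have hl1 : (1 : ℝ) < 1 + ε₀ := by linarith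
  have hε : (-1 : ℝ) < ε₀ := by linarith
  have hΛ : 0 < bigLam ε₀ := bigLam_pos hε
  have hT : 0 < tStar := hV.pos
  set cs : ℝ := 1 / (32 * (3 + bigLam ε₀)) with hcs
  have hcs0 : 0 < cs := by rw [hcs]; positivity
  obtain ⟨K₁, t₁, hK₁, ht₁T, hclock⟩ := frontClock_of_typeOne hε₀ hν hα hV hT1
  obtain ⟨Q, t₂, ht₂T, henv⟩ := hEnv
  obtain ⟨C₀, hC₀⟩ := hT1
  set C : ℝ := 2 * max C₀ 0 with hCdef
  have htypeI : ∀ (n : ℤ) (t : ℝ), 0 ≤ t → t < tStar → bigLam ε₀ ^ n * (tStar - t) * ‖shellVec X n t‖ ≤ C := by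
    intro n t ht0 htT
    have hLt : 0 < bigLam ε₀ ^ n * (tStar - t) := mul_pos (zpow_pos hΛ n) (by linarith)
    have hcomp : ∀ j : Fin 4, |X j n t| ≤ max C₀ 0 / (bigLam ε₀ ^ n * (tStar - t)) := by
      intro j
      rw [le_div_iff₀ hLt]
      calc |X j n t| * (bigLam ε₀ ^ n * (tStar - t)) = bigLam ε₀ ^ n * |X j n t| * (tStar - t) := by ring
        _ ≤ C₀ := hC₀ t ht0 htT j n
        _ ≤ max C₀ 0 := le_max_left _ _
    have h := norm_shellVec_le_two_mul (div_nonneg (le_max_right _ _) hLt.le) hcomp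
    have hne : bigLam ε₀ ^ n * (tStar - t) ≠ 0 := hLt.ne'
    calc bigLam ε₀ ^ n * (tStar - t) * ‖shellVec X n t‖
        ≤ bigLam ε₀ ^ n * (tStar - t) * (2 * (max C₀ 0 / (bigLam ε₀ ^ n * (tStar - t)))) :=
          mul_le_mul_of_nonneg_left h hLt.le
      _ = C := by rw [hCdef, mul_comm (2 : ℝ) _, ← mul_assoc, mul_div_cancel₀ _ hne, mul_comm]
  set W : ℤ → ℝ → Em 4 := fun n σ => (bigLam ε₀ ^ n * Real.exp (-σ)) • shellVec X n (tStar - Real.exp (-σ)) with hWdef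
  have hW : ∀ n σ, W n σ = (bigLam ε₀ ^ n * Real.exp (-σ)) • shellVec X n (tStar - Real.exp (-σ)) := fun n σ => rfl
  obtain ⟨t₃, ht₃T, hwc⟩ := hWC
  set t₀ : ℝ := max (max t₁ t₂) (max t₃ 0) with ht₀
  have ht₀T : t₀ < tStar := max_lt (max_lt ht₁T ht₂T) (max_lt ht₃T hT)
  have hgap : 0 < tStar - t₀ := by linarith
  have hfront : ∀ t : ℝ, 0 ≤ t → t < tStar → ∃ (i : Fin 4) (F : ℤ), cs ≤ bigLam ε₀ ^ F * |X i F t| * (tStar - t) :=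
    fun t ht0 htT => typeOne_quantity_lower_bound hε₀ hν hα hV hB t ht0 htT
  choose! iF FF hFF using hfront
  have h0t₀ : 0 ≤ t₀ := (le_max_right _ _).trans (le_max_right _ _)
  have h1t₀ : t₁ ≤ t₀ := (le_max_left _ _).trans (le_max_left _ _)
  have h2t₀ : t₂ ≤ t₀ := (le_max_right _ _).trans (le_max_left _ _)
  have h3t₀ : t₃ ≤ t₀ := (le_max_left _ _).trans (le_max_right _ _)
  have hQpos : 0 < Q := by
    have h := henv t₀ h0t₀ h2t₀ ht₀T (iF t₀) (FF t₀)
      (hFF t₀ h0t₀ ht₀T)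
    have hX : X (iF t₀) (FF t₀) t₀ ≠ 0 := by
      intro h0
      have := hFF t₀ h0t₀ ht₀T
      rw [h0, abs_zero, mul_zero, zero_mul] at this
      exact absurd this (not_le.2 hcs0)
    exact lt_of_lt_of_le (mul_pos (Real.rpow_pos_of_pos hl0 _) (abs_pos.2 hX)) h
  set m₁ : ℝ := cs * ν / Q with hm₁
  have hm₁0 : 0 < m₁ := by rw [hm₁]; positivity
  have hlow : ∀ t : ℝ, t₀ ≤ t → t < tStar → m₁ ≤ ν * (1 + ε₀) ^ ((2 : ℝ) * FF t) * (tStar - t) := by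
    intro t ht htT
    have ht0 : 0 ≤ t := h0t₀.trans ht
    have ht2 : t₂ ≤ t := h2t₀.trans ht
    exact lowerClock_of_frontEnvelope hε hν.le hcs0 (hFF t ht0 htT) (henv t ht0 ht2 htT _ _ (hFF t ht0 htT))
  have hup : ∀ t : ℝ, t₀ ≤ t → t < tStar → ν * (1 + ε₀) ^ ((2 : ℝ) * FF t) * (tStar - t) < K₁ := by
    intro t ht htT
    have ht0 : 0 ≤ t := h0t₀.trans ht
    have ht1 : t₁ ≤ t := h1t₀.trans ht
    exact hclock t ht0 ht1 htT _ _ (hFF t ht0 htT)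
  have hmK : m₁ < K₁ := lt_of_le_of_lt (hlow t₀ le_rfl ht₀T) (hup t₀ le_rfl ht₀T)
  set S₀ : ℝ := -Real.log (tStar - t₀) with hS₀
  set s : ℕ → ℝ := fun j => (j : ℝ) + S₀ with hs_def
  have hs : Tendsto s atTop atTop := tendsto_atTop_add_const_right _ _ tendsto_natCast_atTop_atTop
  have hexp_s : ∀ j : ℕ, Real.exp (-(s j)) = Real.exp (-(j : ℝ)) * (tStar - t₀) := by
    intro j
    show Real.exp (-((j : ℝ) + S₀)) = _
    rw [hS₀, neg_add, neg_neg, Real.exp_add, Real.exp_log hgap]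
  set tj : ℕ → ℝ := fun j => tStar - Real.exp (-(s j)) with htj
  have htj_lt : ∀ j, tj j < tStar := fun j => by
    show tStar - Real.exp (-(s j)) < tStar
    linarith [Real.exp_pos (-(s j))]
  have htj_ge : ∀ j, t₀ ≤ tj j := by
    intro j
    show t₀ ≤ tStar - Real.exp (-(s j))
    rw [hexp_s j]
    have h1 : Real.exp (-(j : ℝ)) ≤ 1 := Real.exp_le_one_iff.2 (by simp)
    nlinarith
  have htj0 : ∀ j, 0 ≤ tj j := fun j => h0t₀.trans (htj_ge j)
  have hTtj : ∀ j, tStar - tj j = Real.exp (-(s j)) := fun j => by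
    show tStar - (tStar - Real.exp (-(s j))) = _; ring
  set d : ℕ → ℤ := fun j => FF (tj j) with hd
  have hr : ∀ j, ν * (1 + ε₀) ^ ((2 : ℝ) * d j) * Real.exp (-(s j)) ∈ Icc 0 K₁ := by
    intro j
    refine ⟨mul_nonneg (mul_nonneg hν.le (Real.rpow_nonneg hl0.le _)) (Real.exp_pos _).le, ?_⟩
    rw [← hTtj j]
    exact (hup (tj j) (htj_ge j) (htj_lt j)).le
  obtain ⟨φ, hφ, νh, hνh, hrlim, Wlim, hconv, hlaw, hbdd⟩ :=
    viscousEternalLawLimit_of_typeI hε₀ hν.le hT hV.contDiffOn hV.motion hW htypeI d s hs hr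
  have hνm : m₁ ≤ νh := by
    refine ge_of_tendsto hrlim (Eventually.of_forall fun j => ?_)
    have := hlow (tj (φ j)) (htj_ge (φ j)) (htj_lt (φ j))
    rwa [hTtj (φ j)] at this
  have hframe : ∀ (j : ℕ) (N : ℕ), ∃ n : ℤ,
      m₁ / K₁ * Real.exp (N : ℝ) ≤ (1 + ε₀) ^ ((2 : ℝ) * n) ∧ (1 + ε₀) ^ ((2 : ℝ) * n) ≤ K₁ / m₁ * Real.exp (N : ℝ) ∧
      cs ≤ ‖W (n + d j) ((N : ℝ) + s j)‖ := by
    intro j N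
    set t' : ℝ := tStar - Real.exp (-(((N : ℝ) + s j))) with ht'
    have hTt' : tStar - t' = (tStar - tj j) * Real.exp (-(N : ℝ)) := by
      rw [hTtj j, ht']
      rw [show -((N : ℝ) + s j) = -(s j) + -(N : ℝ) by ring, Real.exp_add]
      ring
    have ht'lt : t' < tStar := by rw [ht']; linarith [Real.exp_pos (-((N : ℝ) + s j))]
    have ht'ge : tj j ≤ t' := by
      have h1 : Real.exp (-(N : ℝ)) ≤ 1 := Real.exp_le_one_iff.2 (by simp)
      have h2 : 0 < tStar - tj j := by linarith [htj_lt j]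
      nlinarith
    have ht'0 : t₀ ≤ t' := (htj_ge j).trans ht'ge
    have hwin := relativeShell_window hε hm₁0 (htj_lt j) (hlow _ (htj_ge j) (htj_lt j)) (hup _ (htj_ge j) (htj_lt j)).le
        (hlow _ ht'0 ht'lt) (hup _ ht'0 ht'lt).le hTt'
    have hdj : d j = FF (tj j) := rfl
    have hcast : (((FF t' - d j : ℤ) : ℝ)) = (FF t' : ℝ) - (FF (tj j) : ℝ) := by rw [hdj]; push_cast; ring
    refine ⟨FF t' - d j, ?_, ?_, ?_⟩
    · rw [hcast]; exact hwin.1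
    · rw [hcast]; exact hwin.2
    · rw [sub_add_cancel, renormalisedFlow_norm hε₀ hW (FF t') ((N : ℝ) + s j)]
      have ht'eq : tStar - Real.exp (-((N : ℝ) + s j)) = t' := rfl
      rw [ht'eq]
      have hexp' : Real.exp (-((N : ℝ) + s j)) = tStar - t' := by rw [ht']; ring
      rw [hexp']
      have h1 := abs_apply_le_norm_shellVec X (FF t') t' (iF t')
      have h2 : 0 ≤ bigLam ε₀ ^ FF t' * (tStar - t') := (mul_pos (zpow_pos hΛ _) (by linarith)).le
      calc cs ≤ bigLam ε₀ ^ FF t' * |X (iF t') (FF t') t'| * (tStar - t') := hFF t' ((htj0 j).trans ht'ge) ht'lt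
        _ = bigLam ε₀ ^ FF t' * (tStar - t') * |X (iF t') (FF t') t'| := by ring
        _ ≤ bigLam ε₀ ^ FF t' * (tStar - t') * ‖shellVec X (FF t') t'‖ := mul_le_mul_of_nonneg_left h1 h2
  have hsurvN : ∀ N : ℕ, m₁ / K₁ * Real.exp (N : ℝ) ≥ 1 →
      ∃ n : ℕ, m₁ / K₁ * Real.exp (N : ℝ) ≤ (1 + ε₀) ^ ((2 : ℝ) * (n : ℤ)) ∧
        (1 + ε₀) ^ ((2 : ℝ) * (n : ℤ)) ≤ K₁ / m₁ * Real.exp (N : ℝ) ∧ cs ≤ ‖Wlim n (N : ℝ)‖ := by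
    intro N hN1
    choose nn hlo' hhi' hcs' using fun j => hframe (φ j) N
    have hnn0 : ∀ j, 0 ≤ nn j := by
      intro j
      by_contra hneg
      push Not at hneg
      have hlt : (1 + ε₀) ^ ((2 : ℝ) * (nn j : ℝ)) < 1 := by
        have : (2 : ℝ) * (nn j : ℝ) < 0 := by
          have : ((nn j : ℤ) : ℝ) < 0 := by exact_mod_cast hneg
          linarith
        exact Real.rpow_lt_one_of_one_lt_of_neg hl1 this
      linarith [hlo' j]
    set U : ℝ := (Real.log (K₁ / m₁) + N) / (2 * Real.log (1 + ε₀)) with hU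
    have hlog : 0 < Real.log (1 + ε₀) := Real.log_pos hl1
    have hnnU : ∀ j, (nn j : ℝ) ≤ U := by
      intro j
      have h := hhi' j
      have hpos : 0 < K₁ / m₁ * Real.exp (N : ℝ) := by positivity
      have h2 := Real.log_le_log (Real.rpow_pos_of_pos hl0 _) h
      rw [Real.log_rpow hl0, Real.log_mul (by positivity) (Real.exp_pos _).ne', Real.log_exp] at h2
      rw [hU, le_div_iff₀ (by positivity)]
      linarith
    obtain ⟨Umax, hUmax⟩ := exists_nat_ge U
    have hmem : ∀ j, (nn j).toNat ∈ Finset.range (Umax + 1) := by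
      intro j
      rw [Finset.mem_range]
      have h1 : ((nn j).toNat : ℝ) ≤ U := by
        have : ((nn j).toNat : ℤ) = nn j := Int.toNat_of_nonneg (hnn0 j)
        have h2 : ((nn j).toNat : ℝ) = ((nn j : ℤ) : ℝ) := by exact_mod_cast this
        rw [h2]; exact hnnU j
      have : ((nn j).toNat : ℝ) < Umax + 1 := by linarith
      exact_mod_cast this
    have hfreq : ∃ n ∈ Finset.range (Umax + 1), ∃ᶠ j in atTop, (nn j).toNat = n := by
      by_contra hcon
      push Not at hcon
      have hev : ∀ᶠ j in atTop, ∀ n ∈ Finset.range (Umax + 1), (nn j).toNat ≠ n :=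
        (eventually_all_finset _).2 fun n hn => (hcon n hn)
      obtain ⟨j, hj⟩ := hev.exists
      exact hj _ (hmem j) rfl
    obtain ⟨n, -, hn⟩ := hfreq
    obtain ⟨ψ, hψ, hψn⟩ := extraction_of_frequently_atTop hn
    have hnnψ : ∀ k, nn (ψ k) = (n : ℤ) := by
      intro k
      rw [← hψn k]
      exact (Int.toNat_of_nonneg (hnn0 (ψ k))).symm
    refine ⟨n, ?_, ?_, ?_⟩
    · have := hlo' (ψ 0); rwa [hnnψ 0] at this
    · have := hhi' (ψ 0); rwa [hnnψ 0] at this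
    · -- continuous convergence along `φ ∘ ψ` at the constant log-time `N`
      have hc := ((hconv (n : ℤ) (fun _ => (N : ℝ)) (N : ℝ) tendsto_const_nhds).comp hψ.tendsto_atTop).norm
      refine ge_of_tendsto hc (Eventually.of_forall fun k => ?_)
      have := hcs' (ψ k)
      rw [hnnψ k] at this
      simpa only [Function.comp] using this
  have hbddW : ∀ (n : ℤ) (σ : ℝ), 0 ≤ σ → Real.exp (2 * σ) * ‖Wlim n σ‖ ^ 2 ≤ (P n) ^ 2 := by
    intro n σ hσ
    have hframe_bdd : ∀ j, Real.exp σ * ‖W (n + d (φ j)) (σ + s (φ j))‖ ≤ P n := by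
      intro j
      set t : ℝ := tStar - Real.exp (-(σ + s (φ j))) with htdef
      have hTt : tStar - t = Real.exp (-(σ + s (φ j))) := by rw [htdef]; ring
      have htge : tj (φ j) ≤ t := by
        show tStar - Real.exp (-(s (φ j))) ≤ tStar - Real.exp (-(σ + s (φ j)))
        have : Real.exp (-(σ + s (φ j))) ≤ Real.exp (-(s (φ j))) := Real.exp_le_exp.2 (by linarith)
        linarith
      have htlt : t < tStar := by rw [htdef]; linarith [Real.exp_pos (-(σ + s (φ j)))]
      have hw := hwc (tj (φ j)) (htj0 (φ j)) (h3t₀.trans (htj_ge (φ j))) (htj_lt (φ j)) (iF (tj (φ j))) (d (φ j))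
        (hFF (tj (φ j)) (htj0 (φ j)) (htj_lt (φ j))) n t htge htlt
      rw [renormalisedFlow_norm hε₀ hW (n + d (φ j)) (σ + s (φ j))]
      have ht' : tStar - Real.exp (-(σ + s (φ j))) = t := rfl
      rw [ht']
      have hexp : Real.exp σ * (bigLam ε₀ ^ (n + d (φ j)) * Real.exp (-(σ + s (φ j)))) =
          bigLam ε₀ ^ (n + d (φ j)) * (tStar - tj (φ j)) := by
        rw [hTtj (φ j), show -(σ + s (φ j)) = -(s (φ j)) + -σ by ring, Real.exp_add]
        have : Real.exp σ * Real.exp (-σ) = 1 := by rw [← Real.exp_add, add_neg_cancel, Real.exp_zero]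
        calc Real.exp σ * (bigLam ε₀ ^ (n + d (φ j)) * (Real.exp (-(s (φ j))) * Real.exp (-σ)))
            = bigLam ε₀ ^ (n + d (φ j)) * Real.exp (-(s (φ j))) * (Real.exp σ * Real.exp (-σ)) := by ring
          _ = bigLam ε₀ ^ (n + d (φ j)) * Real.exp (-(s (φ j))) := by rw [this, mul_one]
      calc Real.exp σ * (bigLam ε₀ ^ (n + d (φ j)) * Real.exp (-(σ + s (φ j))) * ‖shellVec X (n + d (φ j)) t‖)
          = bigLam ε₀ ^ (n + d (φ j)) * (tStar - tj (φ j)) * ‖shellVec X (n + d (φ j)) t‖ := by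
            rw [← hexp]; ring
        _ ≤ P n := hw
    have hc := (hconv n (fun _ => σ) σ tendsto_const_nhds).norm
    have hlim : Real.exp σ * ‖Wlim n σ‖ ≤ P n :=
      le_of_tendsto (hc.const_mul (Real.exp σ)) (Eventually.of_forall hframe_bdd)
    have h0 : 0 ≤ Real.exp σ * ‖Wlim n σ‖ := by positivity
    have hsq := pow_le_pow_left₀ h0 hlim 2
    calc Real.exp (2 * σ) * ‖Wlim n σ‖ ^ 2 = (Real.exp σ * ‖Wlim n σ‖) ^ 2 := by
          rw [mul_pow, sq (Real.exp σ), ← Real.exp_add]; ring_nf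
      _ ≤ P n ^ 2 := hsq
  have hnontriv : 1 / (32 * (3 + bigLam ε₀)) ≤ ‖Wlim 0 0‖ := by
    have hanchor : ∀ j, cs ≤ ‖W (0 + d (φ j)) (0 + s (φ j))‖ := by
      intro j
      rw [zero_add, zero_add, renormalisedFlow_norm hε₀ hW (d (φ j)) (s (φ j))]
      have ht : tStar - Real.exp (-(s (φ j))) = tj (φ j) := rfl
      rw [ht, ← hTtj (φ j)]
      have h1 := abs_apply_le_norm_shellVec X (d (φ j)) (tj (φ j)) (iF (tj (φ j)))
      have h2 : 0 ≤ bigLam ε₀ ^ d (φ j) * (tStar - tj (φ j)) :=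
        (mul_pos (zpow_pos hΛ _) (by linarith [htj_lt (φ j)])).le
      calc cs ≤ bigLam ε₀ ^ d (φ j) * |X (iF (tj (φ j))) (d (φ j)) (tj (φ j))| * (tStar - tj (φ j)) :=
            hFF (tj (φ j)) (htj0 (φ j)) (htj_lt (φ j))
        _ = bigLam ε₀ ^ d (φ j) * (tStar - tj (φ j)) * |X (iF (tj (φ j))) (d (φ j)) (tj (φ j))| := by ring
        _ ≤ bigLam ε₀ ^ d (φ j) * (tStar - tj (φ j)) * ‖shellVec X (d (φ j)) (tj (φ j))‖ :=
            mul_le_mul_of_nonneg_left h1 h2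
    have hc := (hconv 0 (fun _ => (0 : ℝ)) 0 tendsto_const_nhds).norm
    exact ge_of_tendsto hc (Eventually.of_forall hanchor)
  have hsurv : EternalSurvivingFwd 1 ε₀ Wlim := by
    refine ⟨cs ^ 2 * (m₁ / K₁) ^ 2, by positivity, fun N₀ => ?_⟩
    obtain ⟨N, hN⟩ := exists_nat_ge (max (N₀ : ℝ) (Real.log (K₁ / m₁) + 2 * Real.log (1 + ε₀) * N₀))
    have hNN₀ : (N₀ : ℝ) ≤ N := (le_max_left _ _).trans hN
    have hNlog : Real.log (K₁ / m₁) + 2 * Real.log (1 + ε₀) * N₀ ≤ N := (le_max_right _ _).trans hN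
    have hlogpos : 0 ≤ Real.log (K₁ / m₁) := Real.log_nonneg (by rw [le_div_iff₀ hm₁0]; linarith)
    have hpowN₀ : (1 + ε₀) ^ ((2 : ℝ) * (N₀ : ℤ)) ≤ m₁ / K₁ * Real.exp (N : ℝ) := by
      have h1 : (1 + ε₀) ^ ((2 : ℝ) * (N₀ : ℤ)) = Real.exp (2 * Real.log (1 + ε₀) * N₀) := by
        rw [Real.rpow_def_of_pos hl0]; congr 1; push_cast; ring
      rw [h1]
      have h2 : m₁ / K₁ * Real.exp (N : ℝ) = Real.exp ((N : ℝ) - Real.log (K₁ / m₁)) := by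
        rw [Real.exp_sub, Real.exp_log (by positivity)]
        field_simp
      rw [h2]
      exact Real.exp_le_exp.2 (by linarith)
    have hN1 : m₁ / K₁ * Real.exp (N : ℝ) ≥ 1 := by
      have : (1 : ℝ) ≤ (1 + ε₀) ^ ((2 : ℝ) * (N₀ : ℤ)) := Real.one_le_rpow hl1.le (by positivity)
      exact this.trans hpowN₀
    obtain ⟨n, hlo, hhi, hcsW⟩ := hsurvN N hN1
    have hnN₀ : N₀ ≤ n := by
      have h := hpowN₀.trans hlo
      rw [Real.rpow_le_rpow_left_iff hl1] at h
      have : ((N₀ : ℤ) : ℝ) ≤ ((n : ℤ) : ℝ) := by linarith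
      exact_mod_cast this
    refine ⟨n, hnN₀, (N : ℝ), by exact_mod_cast hNN₀, ?_⟩
    exact frameWeightedEnergy_ge hε₀ hm₁0 hK₁ hcs0.le hhi hcsW
  set a : ℕ → ℝ := fun j => -Real.log tStar - s j with ha_def
  have hwin : ∀ (j : ℕ) (u : ℝ), a j < u → Real.exp (-(u + s j)) < tStar := by
    intro j u hu
    have hu' : -(u + s j) < Real.log tStar := by
      have : -Real.log tStar - s j < u := hu
      linarith
    calc Real.exp (-(u + s j)) < Real.exp (Real.log tStar) := Real.exp_lt_exp.2 hu'
      _ = tStar := Real.exp_log hT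
  have ha : Tendsto a atTop atBot := by
    refine tendsto_atBot.2 fun b => ?_
    exact (hs.eventually (eventually_ge_atTop (-Real.log tStar - b))).mono fun j hj => by
      show -Real.log tStar - s j ≤ b
      linarith
  have hev : ∀ a' : ℝ, ∀ᶠ j in atTop, a (φ j) < a' := fun a' =>
    (ha.comp hφ.tendsto_atTop).eventually (eventually_lt_atBot a')
  have hgcont : ∀ (j : ℕ) (n : ℤ) (u : ℝ), a j < u → ContinuousAt (fun u => W (n + d j) (u + s j)) u := by
    intro j n u hu
    exact ((renormalisedViscousFlow_law hε₀ hV.contDiffOn hV.motion hW (n + d j) (hwin j u hu)).comp_add_const u (s j)).continuousAt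
  have hgbd : ∀ (j : ℕ) (n : ℤ) (u : ℝ), a j < u → ‖W (n + d j) (u + s j)‖ ≤ C := fun j n u hu =>
    (uniformBound_iff_typeI (C := C) hε₀ hW).2 htypeI (n + d j) (u + s j) (hwin j u hu).le
  have hpt : ∀ (n : ℤ) (σ : ℝ), Tendsto (fun j => W (n + d (φ j)) (σ + s (φ j))) atTop (𝓝 (Wlim n σ)) :=
    fun n σ => hconv n (fun _ => σ) σ tendsto_const_nhds
  have hcontW : ∀ n : ℤ, Continuous (Wlim n) := fun n =>
    continuous_iff_continuousAt.2 fun σ => (hlaw n σ).continuousAt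
  have hwin_int : ∀ (n : ℤ) (a' b : ℝ), a' ≤ b → ∫ u in a'..b, ‖Wlim n u‖ ≤ A := by
    intro n a' b hab
    have hlim : Tendsto (fun j => ∫ u in a'..b, ‖W (n + d (φ j)) (u + s (φ j))‖) atTop (𝓝 (∫ u in a'..b, ‖Wlim n u‖)) := by
      refine intervalIntegral.tendsto_integral_filter_of_dominated_convergence (fun _ => C) ?_ ?_ intervalIntegrable_const ?_
      · refine (hev a').mono fun j hj => ?_
        refine ContinuousOn.aestronglyMeasurable ?_ measurableSet_uIoc
        intro u hu
        rw [Set.uIoc_of_le hab] at hu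
        exact ((hgcont (φ j) n u (lt_trans hj hu.1)).norm).continuousWithinAt
      · refine (hev a').mono fun j hj => ae_of_all _ fun u hu => ?_
        rw [Set.uIoc_of_le hab] at hu
        rw [norm_norm]
        exact hgbd (φ j) n u (lt_trans hj hu.1)
      · exact ae_of_all _ fun u _ => (hpt n u).norm
    refine le_of_tendsto hlim ((hev a').mono fun j hj => ?_)
    exact translate_window_action hε₀ hV.contDiffOn hW hUA (n + d (φ j)) (s (φ j)) hab (hwin (φ j) a' hj)
  have haction : ∀ n : ℤ, Integrable (fun σ => ‖Wlim n σ‖) ∧ ∫ σ, ‖Wlim n σ‖ ≤ A := by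
    intro n
    have hcn : Continuous (fun σ => ‖Wlim n σ‖) := (hcontW n).norm
    have hfi : ∀ i : ℕ, IntegrableOn (fun σ => ‖Wlim n σ‖) (Ioc (-(i : ℝ)) i) := fun i =>
      (hcn.integrableOn_Icc).mono_set Ioc_subset_Icc_self
    have hai : Tendsto (fun i : ℕ => -(i : ℝ)) atTop atBot :=
      tendsto_neg_atTop_atBot.comp tendsto_natCast_atTop_atTop
    have hbi : Tendsto (fun i : ℕ => (i : ℝ)) atTop atTop := tendsto_natCast_atTop_atTop
    have hii : ∀ i : ℕ, -(i : ℝ) ≤ i := fun i => by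
      have h0 : (0 : ℝ) ≤ i := Nat.cast_nonneg i
      linarith
    have hInt : Integrable (fun σ => ‖Wlim n σ‖) := by
      refine integrable_of_intervalIntegral_norm_bounded A hfi hai hbi (Eventually.of_forall fun i => ?_)
      simp only [norm_norm]
      exact hwin_int n _ _ (hii i)
    exact ⟨hInt, le_of_tendsto' (intervalIntegral_tendsto_integral hInt hai hbi) fun i => hwin_int n _ _ (hii i)⟩
  refine ⟨νh, lt_of_lt_of_le hm₁0 hνm, Wlim, ⟨hlaw, hνh.1, ⟨A, haction⟩, fun n => ⟨0, (P n) ^ 2, fun σ hσ => hbddW n σ hσ⟩⟩,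
    ⟨C, hbdd⟩, hsurv, hnontriv⟩

end Summit.NavierStokesRegularity.NavierStokesRegularity.Theorems.EternalRigidityViscBddOne.ViscousLawLimit

end
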